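import Mathlib
import HarnessLib
import Summits.NavierStokesRegularity.NavierStokesRegularity.Theorems.HalfSpaceWindowDoorCirculationCarryingRigidityGaussExtremalInvariant

/-!
# Route `HalfSpaceWindowDoor`, crux `CirculationCarryingRigidity` (stmt-NavierStokesRegularity-25311) —
# census row: the CONE stratum of Lei–Ren–Tian in the TIME-ONLY class, below the explicit threshold `C(1+K) < 1`

LEAD ns-hsw-p1 g9 (cell pub-ns-dss), `--supports stmt-NavierStokesRegularity-25311 --as helper`; first consumer of the tool
`…GaussExtremalInvariant` (line `blowdown`, card `Cruxes/CirculationCarryingRigidity/Lines/blowdown.md`).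

Lei–Ren–Tian (arXiv:2501.08976, Thm 1.1 / Remark 1.2) prove regularity of suitable weak solutions whose vorticity directions stay in a
DOUBLE CONE `|ω_h| ≤ K|ω₃|` (about high-vorticity regions); their Remark 1.3 records the half-space case `ω₃ ≥ 0` (opening angle `π`)
as open — this is W6 (`HemisphereLiouvilleE3`) for the door class.  Their flux-decay iteration (§4) needs the local energy near the apex
(`sup_{Q(r)} Γ < ∞`), which the TIME-ONLY door class `‖v(t)‖_∞ ≤ C/√(−t)` does not supply; in the tree the cone stratum is dead only in
the axis-Type-I and space–time Type-I sub-classes (`…TiltDominatedLiouville`, `…PointwiseConeLiouville`, `…AxisTypeILiouville`).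

THIS FILE (time-only class, no space decay, no local energy): the SINGLE cone `‖ω_h‖ ≤ K·ω₃` (vortex lines everywhere at slope `≥ 1/K`
against the horizontal) is a backward-shift / zoom invariant, F3-closed property, so it is carried by the ONE Gaussian-extremal profile `W`
of `…GaussExtremalInvariant`; there the tilting package of `…GaussExtremalJoint` pins the Gaussian TILTING moment from below,
`(2 − 2C)·M₀ ≤ 𝒯 = ∫G₁(x_h·ω_h)u₃`, while the cone and the horizontal Hessian moment `∫G₁|x_h|²ω₃ ≤ 4M₀` bound it from above,
`𝒯 ≤ K·C·∫G₁‖x_h‖ω₃ ≤ 2KC·M₀` (`‖x_h‖ ≤ ‖x_h‖²/4 + 1`).  Hence `1 ≤ C(1 + K)` for every enemy: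

* `inner_curl_e3_eq_zero_of_cone` — door class (constant `C`) + `‖ω_h‖ ≤ Kω₃` everywhere + `C(1+K) < 1` ⇒ poloidal;
* `curl_eq_zero_of_cone`, `eq_zero_of_cone`, `not_isBackwardSingularPoint_of_cone` — hence irrotational, hence `v ≡ 0` (one vorticity-free
  slice kills, `eq_zero_of_curl_parallel_slice`), hence the apex is not backward-singular;
* `eq_zero_of_vorticity_cone` — the same under LRT's spelling `‖ω‖ ≤ K'·ω₃` (`K = K'`).

An EXPLICIT, non-perturbative smallness threshold depending only on the opening of the cone (the tree's unconditional small-data Liouville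
`…ForwardSmallness` has an implicit `ε`); for `C(1+K) ≥ 1` the cone stratum of the time-only class stays open (the honest limit of the
blowdown line: no lower bound on `M₀`).  WHAT THIS IS NOT: not a statement about Navier–Stokes regularity; door statements concern HYPOTHETICAL
blow-up profiles (KNSS ancient mild solutions).  No item is closed by this file.
-/

noncomputable section

-- the summit and its single sub-problem share the name (CONVENTIONS §1), as in every Theorems file
set_option linter.dupNamespace false

namespace Summit.NavierStokesRegularity.NavierStokesRegularity.Theorems.HalfSpaceWindowDoorCirculationCarryingRigidityGaussExtremalCone

open MeasureTheory Set Function Filter Topology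
open scoped RealInnerProductSpace InnerProductSpace
open Literature.Analysis Literature.Analysis.FluidPDE Literature.Analysis.UnboundedOperators
open Summit.NavierStokesRegularity.NavierStokesRegularity.Theses.HalfSpaceWindowDoor
open Summit.NavierStokesRegularity.NavierStokesRegularity.Theorems.HalfSpaceWindowDoorCirculationCarryingRigidityDefs
open Summit.NavierStokesRegularity.NavierStokesRegularity.Theorems.HalfSpaceWindowDoorCirculationCarryingRigidityGaussKernel
  (inner_e3_apply)
open Summit.NavierStokesRegularity.NavierStokesRegularity.Theorems.HalfSpaceWindowDoorCirculationCarryingRigidityGaussExtremalConditions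
  (omega3_continuous_bounded)
open Summit.NavierStokesRegularity.NavierStokesRegularity.Theorems.HalfSpaceWindowDoorCirculationCarryingRigidityGaussExtremalTilting
  (slice_components abs_horiz_dot_le_two)
open Summit.NavierStokesRegularity.NavierStokesRegularity.Theorems.HalfSpaceWindowDoorCirculationCarryingRigidityHorizontalVorticityFloor
  (tendsto_curl_of_tendsto_fderiv eq_zero_of_curl_parallel_slice eq_smul_e3_of_apply_eq_zero)
open Summit.NavierStokesRegularity.NavierStokesRegularity.Theorems.PoloidalWindowDoorPoloidalWindowRigidityWindow
  (isTypeIAncientMild_of_class)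
open Summit.NavierStokesRegularity.NavierStokesRegularity.Theorems.HalfSpaceWindowDoorCirculationCarryingRigidityGaussExtremalInvariant
  (inner_curl_e3_eq_zero_of_invariant_joint)

variable {C : ℝ}

/-! ### Pointwise algebra -/

/-- Horizontal Cauchy–Schwarz + AM–GM under the cone: if `√(w₀² + w₁²) ≤ K·w₂` then
`|y₀w₀ + y₁w₁| ≤ K·((y₀² + y₁²)/4 + 1)·w₂` (`|y_h·w_h| ≤ ‖y_h‖‖w_h‖`, `‖y_h‖ ≤ ‖y_h‖²/4 + 1`). -/
theorem abs_horiz_dot_le_of_cone (y w : EuclideanSpace ℝ (Fin 3)) {K : ℝ}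
    (hw : Real.sqrt (w 0 ^ 2 + w 1 ^ 2) ≤ K * w 2) :
    |y 0 * w 0 + y 1 * w 1| ≤ K * ((y 0 ^ 2 + y 1 ^ 2) / 4 + 1) * w 2 := by
  set ρ : ℝ := Real.sqrt (y 0 ^ 2 + y 1 ^ 2) with hρ
  set q : ℝ := Real.sqrt (w 0 ^ 2 + w 1 ^ 2) with hq
  have hρ0 : 0 ≤ ρ := Real.sqrt_nonneg _
  have hq0 : 0 ≤ q := Real.sqrt_nonneg _
  have hρ2 : ρ ^ 2 = y 0 ^ 2 + y 1 ^ 2 := Real.sq_sqrt (by positivity)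
  have hq2 : q ^ 2 = w 0 ^ 2 + w 1 ^ 2 := Real.sq_sqrt (by positivity)
  have hlag : (y 0 * w 0 + y 1 * w 1) ^ 2 ≤ (ρ * q) ^ 2 := by
    rw [mul_pow, hρ2, hq2]
    nlinarith [sq_nonneg (y 0 * w 1 - y 1 * w 0)]
  have h1 : |y 0 * w 0 + y 1 * w 1| ≤ ρ * q := abs_le_of_sq_le_sq hlag (mul_nonneg hρ0 hq0)
  have h2 : ρ ≤ (y 0 ^ 2 + y 1 ^ 2) / 4 + 1 := by rw [← hρ2]; nlinarith [sq_nonneg (ρ - 2)]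
  have hKw : 0 ≤ K * w 2 := hq0.trans hw
  calc |y 0 * w 0 + y 1 * w 1| ≤ ρ * q := h1
    _ ≤ ((y 0 ^ 2 + y 1 ^ 2) / 4 + 1) * (K * w 2) := mul_le_mul h2 hw hq0 (by positivity)
    _ = K * ((y 0 ^ 2 + y 1 ^ 2) / 4 + 1) * w 2 := by ring

/-- Under the cone, `ω₃ = 0` forces `ω = 0`. -/
theorem eq_zero_of_cone_of_apply_two_eq_zero (w : EuclideanSpace ℝ (Fin 3)) {K : ℝ}
    (hw : Real.sqrt (w 0 ^ 2 + w 1 ^ 2) ≤ K * w 2) (h2 : w 2 = 0) : w = 0 := by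
  rw [h2, mul_zero] at hw
  have hs : Real.sqrt (w 0 ^ 2 + w 1 ^ 2) = 0 := le_antisymm hw (Real.sqrt_nonneg _)
  rw [Real.sqrt_eq_zero (by positivity)] at hs
  have h0 : w 0 = 0 := by nlinarith [sq_nonneg (w 0), sq_nonneg (w 1)]
  have h1 : w 1 = 0 := by nlinarith [sq_nonneg (w 0), sq_nonneg (w 1)]
  rw [eq_smul_e3_of_apply_eq_zero h0 h1, h2, zero_smul]

/-- The components of a `(c·c)`-multiple. -/
theorem smul_apply_fin3 (a : ℝ) (w : EuclideanSpace ℝ (Fin 3)) (i : Fin 3) : (a • w) i = a * w i := by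
  simp

/-! ### The cone is an invariant, F3-closed sub-class -/

/-- The cone passes to backward time shifts. -/
theorem cone_shift {K : ℝ} {u : ℝ → EuclideanSpace ℝ (Fin 3) → EuclideanSpace ℝ (Fin 3)}
    (hu : ∀ s < 0, ∀ x, Real.sqrt ((curl (u s) x 0) ^ 2 + (curl (u s) x 1) ^ 2) ≤ K * curl (u s) x 2)
    {δ : ℝ} (hδ : 0 ≤ δ) :
    ∀ s < 0, ∀ x, Real.sqrt ((curl ((fun σ => u (σ - δ)) s) x 0) ^ 2 + (curl ((fun σ => u (σ - δ)) s) x 1) ^ 2) ≤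
      K * curl ((fun σ => u (σ - δ)) s) x 2 :=
  fun s hs x => hu (s - δ) (by linarith) x

/-- The cone passes to Navier–Stokes zooms (`curl` of the zoomed slice is `c²` times the zoomed `curl`). -/
theorem cone_zoom {K : ℝ} {u : ℝ → EuclideanSpace ℝ (Fin 3) → EuclideanSpace ℝ (Fin 3)}
    (hu : ∀ s < 0, ∀ x, Real.sqrt ((curl (u s) x 0) ^ 2 + (curl (u s) x 1) ^ 2) ≤ K * curl (u s) x 2)
    {c : ℝ} (hc : 0 < c) (x₀ : EuclideanSpace ℝ (Fin 3)) :
    ∀ s < 0, ∀ x, Real.sqrt ((curl ((c • stPull (c ^ 2) c 0 x₀ u) s) x 0) ^ 2 + (curl ((c • stPull (c ^ 2) c 0 x₀ u) s) x 1) ^ 2) ≤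
      K * curl ((c • stPull (c ^ 2) c 0 x₀ u) s) x 2 := by
  intro s hs x
  have hs' : 0 + c ^ 2 * s < 0 := by rw [zero_add]; exact mul_neg_of_pos_of_neg (pow_pos hc 2) hs
  rw [curl_smul_stPull c (c ^ 2) c 0 x₀ u s x, smul_apply_fin3, smul_apply_fin3, smul_apply_fin3]
  set w := curl (u (0 + c ^ 2 * s)) (x₀ + c • x) with hw
  have hcc : 0 ≤ c * c := mul_self_nonneg c
  have h := hu _ hs' (x₀ + c • x)
  have hsq : Real.sqrt ((c * c * w 0) ^ 2 + (c * c * w 1) ^ 2) = (c * c) * Real.sqrt (w 0 ^ 2 + w 1 ^ 2) := by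
    rw [show (c * c * w 0) ^ 2 + (c * c * w 1) ^ 2 = (c * c) ^ 2 * (w 0 ^ 2 + w 1 ^ 2) by ring,
      Real.sqrt_mul (sq_nonneg _), Real.sqrt_sq hcc]
  rw [hsq]
  calc c * c * Real.sqrt (w 0 ^ 2 + w 1 ^ 2) ≤ c * c * (K * w 2) := mul_le_mul_of_nonneg_left h hcc
    _ = K * (c * c * w 2) := by ring

/-- The cone passes to F3 limits (pointwise convergence of the vorticity suffices). -/
theorem cone_lim {K : ℝ} {w : ℕ → ℝ → EuclideanSpace ℝ (Fin 3) → EuclideanSpace ℝ (Fin 3)}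
    {W : ℝ → EuclideanSpace ℝ (Fin 3) → EuclideanSpace ℝ (Fin 3)}
    (hw : ∀ j, ∀ s < 0, ∀ x, Real.sqrt ((curl (w j s) x 0) ^ 2 + (curl (w j s) x 1) ^ 2) ≤ K * curl (w j s) x 2)
    (hptG : ∀ t < 0, ∀ x, Tendsto (fun j => fderiv ℝ (w j t) x) atTop (𝓝 (fderiv ℝ (W t) x))) :
    ∀ s < 0, ∀ x, Real.sqrt ((curl (W s) x 0) ^ 2 + (curl (W s) x 1) ^ 2) ≤ K * curl (W s) x 2 := by
  intro s hs x
  have hc : Tendsto (fun j => curl (w j s) x) atTop (𝓝 (curl (W s) x)) := tendsto_curl_of_tendsto_fderiv (hptG s hs x)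
  have hci : ∀ i : Fin 3, Continuous fun z : EuclideanSpace ℝ (Fin 3) => z i := fun i =>
    (continuous_apply i).comp (PiLp.continuous_ofLp 2 _)
  have hi : ∀ i : Fin 3, Tendsto (fun j => curl (w j s) x i) atTop (𝓝 (curl (W s) x i)) := fun i =>
    ((hci i).tendsto _).comp hc
  have hL : Tendsto (fun j => Real.sqrt ((curl (w j s) x 0) ^ 2 + (curl (w j s) x 1) ^ 2)) atTop
      (𝓝 (Real.sqrt ((curl (W s) x 0) ^ 2 + (curl (W s) x 1) ^ 2))) :=
    (((hi 0).pow 2).add ((hi 1).pow 2)).sqrt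
  have hR : Tendsto (fun j => K * curl (w j s) x 2) atTop (𝓝 (K * curl (W s) x 2)) := (hi 2).const_mul K
  exact le_of_tendsto_of_tendsto' hL hR fun j => hw j s hs x

/-! ### The kill at the extremal point -/

/-- **No coned profile is Gaussian-extremal when `C(1+K) < 1`.**  For a closed-hemisphere door-class `W` (constant `C`) in the cone
`‖ω_h‖ ≤ Kω₃` whose slice `u = W(−1)` carries `M₀ = ∫G₁ω₃ > 0`, the horizontal moment bound `∫G₁|x_h|²ω₃ ≤ 4M₀` and the lower tilting bound
`(2 − 2C)M₀ ≤ 𝒯 = ∫G₁(x_h·ω_h)u₃` (both hold at the Gaussian-extremal point, `…GaussExtremalJoint`), one has `𝒯 ≤ 2KC·M₀`, hence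
`1 ≤ C(1+K)`. -/
theorem one_le_of_cone_extremal {W : ℝ → EuclideanSpace ℝ (Fin 3) → EuclideanSpace ℝ (Fin 3)} (hW : InDoorClass C W)
    (hWs : SignE3 W) {K : ℝ}
    (hcone : ∀ s < 0, ∀ x, Real.sqrt ((curl (W s) x 0) ^ 2 + (curl (W s) x 1) ^ 2) ≤ K * curl (W s) x 2)
    (h0 : 0 < ∫ y, heatKernel 1 y * curl (W (-1)) y 2)
    (hhor : ∫ y, ((y 0) ^ 2 + (y 1) ^ 2) * heatKernel 1 y * curl (W (-1)) y 2 ≤ 4 * ∫ y, heatKernel 1 y * curl (W (-1)) y 2)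
    (hlo : (2 - 2 * C) * ∫ y, heatKernel 1 y * curl (W (-1)) y 2 ≤
      ∫ y, heatKernel 1 y * ((y 0 * curl (W (-1)) y 0 + y 1 * curl (W (-1)) y 1) * W (-1) y 2)) :
    1 ≤ C * (1 + K) := by
  have hm1 : (-1 : ℝ) < 0 := by norm_num
  set M₀ : ℝ := ∫ y, heatKernel 1 y * curl (W (-1)) y 2 with hM₀
  set Mh : ℝ := ∫ y, ((y 0) ^ 2 + (y 1) ^ 2) * heatKernel 1 y * curl (W (-1)) y 2 with hMh
  set T : ℝ := ∫ y, heatKernel 1 y * ((y 0 * curl (W (-1)) y 0 + y 1 * curl (W (-1)) y 1) * W (-1) y 2) with hT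
  obtain ⟨hvc, -, hωc, K', hωK'⟩ := slice_components hW hm1
  have hvC : ∀ x, ‖W (-1) x‖ ≤ C := fun x => by
    have h := hW.1 (-1) hm1 x; rwa [neg_neg, Real.sqrt_one, div_one] at h
  have hC0 : 0 ≤ C := (norm_nonneg _).trans (hvC 0)
  have hv2 : ∀ x, |W (-1) x 2| ≤ C := fun x =>
    ((Real.norm_eq_abs _).symm.le.trans (PiLp.norm_apply_le (W (-1) x) 2)).trans (hvC x)
  have hω3nn : ∀ x, 0 ≤ curl (W (-1)) x 2 := fun x => by rw [← inner_e3_apply]; exact hWs (-1) hm1 x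
  have hcont_yi : ∀ i : Fin 3, Continuous fun y : EuclideanSpace ℝ (Fin 3) => y i := fun i =>
    (continuous_apply i).comp (PiLp.continuous_ofLp 2 _)
  have hG1c : Continuous fun y : EuclideanSpace ℝ (Fin 3) => heatKernel 1 y := by
    unfold heatKernel; fun_prop
  -- integrability of the three Gaussian moments
  have hmom1 : Integrable (fun y : EuclideanSpace ℝ (Fin 3) => heatKernel 1 y * ‖y‖) :=
    integrable_heatKernel_mul_norm (E := EuclideanSpace ℝ (Fin 3)) one_pos
  have hintT : Integrable (fun y : EuclideanSpace ℝ (Fin 3) =>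
      heatKernel 1 y * ((y 0 * curl (W (-1)) y 0 + y 1 * curl (W (-1)) y 1) * W (-1) y 2)) := by
    have hK'0 : 0 ≤ K' := (abs_nonneg _).trans (hωK' 0 0)
    refine Integrable.mono' (hmom1.const_mul (2 * K' * C)) ?_ (ae_of_all _ fun y => ?_)
    · exact (hG1c.mul ((((hcont_yi 0).mul (hωc 0)).add ((hcont_yi 1).mul (hωc 1))).mul (hvc 2))).aestronglyMeasurable
    · have hG : 0 ≤ heatKernel 1 y := (heatKernel_pos one_pos _).le
      rw [Real.norm_eq_abs, abs_mul, abs_of_nonneg hG, abs_mul]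
      calc heatKernel 1 y * (|y 0 * curl (W (-1)) y 0 + y 1 * curl (W (-1)) y 1| * |W (-1) y 2|)
          ≤ heatKernel 1 y * ((2 * K' * ‖y‖) * C) :=
            mul_le_mul_of_nonneg_left (mul_le_mul (abs_horiz_dot_le_two y (curl (W (-1)) y) (fun i => hωK' i y)) (hv2 y)
              (abs_nonneg _) (by positivity)) hG
        _ = 2 * K' * C * (heatKernel 1 y * ‖y‖) := by ring
  have hint0 : Integrable (fun y : EuclideanSpace ℝ (Fin 3) => heatKernel 1 y * curl (W (-1)) y 2) := by
    obtain ⟨hωc', B, hωB'⟩ := omega3_continuous_bounded hW hm1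
    have h := ((integrable_heatKernel_holds (E := EuclideanSpace ℝ (Fin 3)) one_pos).bdd_mul hωc'.aestronglyMeasurable
      (ae_of_all _ fun x => hωB' x))
    refine h.congr (ae_of_all _ fun x => ?_)
    show ⟪curl (W (-1)) x, e3⟫ * heatKernel 1 x = heatKernel 1 x * curl (W (-1)) x 2
    rw [inner_e3_apply, mul_comm]
  have hinth : Integrable (fun y : EuclideanSpace ℝ (Fin 3) => ((y 0) ^ 2 + (y 1) ^ 2) * heatKernel 1 y * curl (W (-1)) y 2) := by
    obtain ⟨hωc', B, hωB'⟩ := omega3_continuous_bounded hW hm1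
    have h2 := ((integrable_norm_sq_mul_heatKernel (E := EuclideanSpace ℝ (Fin 3)) one_pos).bdd_mul hωc'.aestronglyMeasurable
      (ae_of_all _ fun x => hωB' x))
    refine h2.mono ((((((hcont_yi 0).pow 2).add ((hcont_yi 1).pow 2)).mul hG1c).mul (hωc 2))).aestronglyMeasurable
      (ae_of_all _ fun y => ?_)
    have hG : 0 ≤ heatKernel 1 y := (heatKernel_pos one_pos _).le
    have hq : 0 ≤ (y 0) ^ 2 + (y 1) ^ 2 := by positivity
    have hyq : (y 0) ^ 2 + (y 1) ^ 2 ≤ ‖y‖ ^ 2 := Literature.Analysis.FluidPDE.Wei2016.sq_add_sq_le_norm_sq y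
    have he : ⟪curl (W (-1)) y, e3⟫ = curl (W (-1)) y 2 := inner_e3_apply _
    rw [Real.norm_eq_abs, abs_mul, abs_mul, abs_of_nonneg hq, abs_of_nonneg hG, Real.norm_eq_abs, abs_mul, he, abs_mul,
      abs_of_nonneg (sq_nonneg ‖y‖), abs_of_nonneg hG]
    calc ((y 0) ^ 2 + (y 1) ^ 2) * heatKernel 1 y * |curl (W (-1)) y 2| ≤ ‖y‖ ^ 2 * heatKernel 1 y * |curl (W (-1)) y 2| := by
          gcongr
      _ = |curl (W (-1)) y 2| * (‖y‖ ^ 2 * heatKernel 1 y) := by ring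
  -- the cone bounds the tilting integrand by Gaussian moments of `ω₃`
  have hKnn : 0 ≤ K ∨ M₀ ≤ 0 := by
    by_cases hK : 0 ≤ K
    · exact Or.inl hK
    · right
      -- a negative `K` forces `ω_h = 0` and `ω₃ ≤ 0`, hence `ω₃ = 0`, everywhere: then `M₀ = 0`
      have hz : ∀ x, curl (W (-1)) x 2 = 0 := fun x => by
        have h := hcone (-1) hm1 x
        have hs : 0 ≤ Real.sqrt ((curl (W (-1)) x 0) ^ 2 + (curl (W (-1)) x 1) ^ 2) := Real.sqrt_nonneg _
        nlinarith [hω3nn x, not_le.1 hK]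
      have : M₀ = 0 := by
        simp only [hM₀]
        rw [integral_eq_zero_of_ae (ae_of_all _ fun x => ?_)]
        show heatKernel 1 x * curl (W (-1)) x 2 = 0
        rw [hz x, mul_zero]
      exact this.le
  rcases hKnn with hK | hM
  swap
  · exact absurd hM (not_le.2 h0)
  have hdom : ∀ y : EuclideanSpace ℝ (Fin 3),
      heatKernel 1 y * ((y 0 * curl (W (-1)) y 0 + y 1 * curl (W (-1)) y 1) * W (-1) y 2) ≤
        K * C * ((1 / 4) * (((y 0) ^ 2 + (y 1) ^ 2) * heatKernel 1 y * curl (W (-1)) y 2) + (heatKernel 1 y * curl (W (-1)) y 2)) := by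
    intro y
    have hG : 0 ≤ heatKernel 1 y := (heatKernel_pos one_pos _).le
    have hω := hω3nn y
    have h1 := abs_horiz_dot_le_of_cone y (curl (W (-1)) y) (hcone (-1) hm1 y)
    have h2 : (y 0 * curl (W (-1)) y 0 + y 1 * curl (W (-1)) y 1) * W (-1) y 2 ≤
        (K * ((y 0 ^ 2 + y 1 ^ 2) / 4 + 1) * curl (W (-1)) y 2) * C := by
      have ha := abs_mul (y 0 * curl (W (-1)) y 0 + y 1 * curl (W (-1)) y 1) (W (-1) y 2)
      have hb : |y 0 * curl (W (-1)) y 0 + y 1 * curl (W (-1)) y 1| * |W (-1) y 2| ≤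
          (K * ((y 0 ^ 2 + y 1 ^ 2) / 4 + 1) * curl (W (-1)) y 2) * C :=
        mul_le_mul h1 (hv2 y) (abs_nonneg _) (by positivity)
      exact (le_abs_self _).trans (ha.le.trans hb)
    calc heatKernel 1 y * ((y 0 * curl (W (-1)) y 0 + y 1 * curl (W (-1)) y 1) * W (-1) y 2)
        ≤ heatKernel 1 y * ((K * ((y 0 ^ 2 + y 1 ^ 2) / 4 + 1) * curl (W (-1)) y 2) * C) := mul_le_mul_of_nonneg_left h2 hG
      _ = K * C * ((1 / 4) * (((y 0) ^ 2 + (y 1) ^ 2) * heatKernel 1 y * curl (W (-1)) y 2) + (heatKernel 1 y * curl (W (-1)) y 2)) := by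
          ring
  have hintB : Integrable (fun y : EuclideanSpace ℝ (Fin 3) =>
      K * C * ((1 / 4) * (((y 0) ^ 2 + (y 1) ^ 2) * heatKernel 1 y * curl (W (-1)) y 2) + (heatKernel 1 y * curl (W (-1)) y 2))) :=
    ((hinth.const_mul _).add hint0).const_mul (K * C)
  have hTle := integral_mono hintT hintB hdom
  have hval : ∫ y : EuclideanSpace ℝ (Fin 3),
      K * C * ((1 / 4) * (((y 0) ^ 2 + (y 1) ^ 2) * heatKernel 1 y * curl (W (-1)) y 2) + (heatKernel 1 y * curl (W (-1)) y 2)) =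
      K * C * ((1 / 4) * Mh + M₀) := by
    rw [integral_const_mul, integral_add (hinth.const_mul _) hint0, integral_const_mul]
  rw [hval] at hTle
  have hKC : 0 ≤ K * C := mul_nonneg hK hC0
  have hT2 : T ≤ 2 * K * C * M₀ := by
    calc T ≤ K * C * ((1 / 4) * Mh + M₀) := hTle
      _ ≤ K * C * ((1 / 4) * (4 * M₀) + M₀) := by gcongr
      _ = 2 * K * C * M₀ := by ring
  -- `(2 − 2C)M₀ ≤ 𝒯 ≤ 2KC·M₀` with `M₀ > 0`
  by_contra hlt
  push Not at hlt
  have h1 : (2 - 2 * C) * M₀ ≤ 2 * K * C * M₀ := hlo.trans hT2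
  nlinarith

/-! ### The census row -/

/-- **CENSUS ROW (time-only class): the CONE stratum below `C(1+K) < 1` is poloidal.**  A closed-hemisphere door-class profile (Type-I
time rate `‖v(t)‖ ≤ C/√(−t)`, continuity, unit-viscosity Oseen–Duhamel identity, divergence-free slices, `⟪curl v, e₃⟫ ≥ 0`) whose
vorticity lies everywhere in the cone `‖ω_h‖ ≤ K·ω₃` (`ω_h = (ω₀, ω₁)`), with `C(1 + K) < 1`, has `⟪curl v, e₃⟫ ≡ 0`. -/
theorem inner_curl_e3_eq_zero_of_cone {v : ℝ → EuclideanSpace ℝ (Fin 3) → EuclideanSpace ℝ (Fin 3)} (hv : InDoorClass C v)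
    (hsign : SignE3 v) {K : ℝ}
    (hcone : ∀ s < 0, ∀ x, Real.sqrt ((curl (v s) x 0) ^ 2 + (curl (v s) x 1) ^ 2) ≤ K * curl (v s) x 2)
    (hCK : C * (1 + K) < 1) :
    ∀ s < 0, ∀ y, ⟪curl (v s) y, e3⟫ = 0 := by
  refine inner_curl_e3_eq_zero_of_invariant_joint (C := C)
    (fun u => ∀ s < 0, ∀ x, Real.sqrt ((curl (u s) x 0) ^ 2 + (curl (u s) x 1) ^ 2) ≤ K * curl (u s) x 2)
    (fun u _ hu δ hδ => cone_shift hu hδ) (fun u _ hu c hc x₀ => cone_zoom hu hc x₀)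
    (fun w W _ hw _ _ hptG _ _ => cone_lim hw hptG) ?_ hv hcone hsign
  intro W hW hWs hPW _ hmom htilt _ _
  obtain ⟨h0, -, -, hhor, -, -, -, -⟩ := hmom
  obtain ⟨-, -, hlo, -, -, -⟩ := htilt
  have h := one_le_of_cone_extremal hW hWs hPW h0 hhor hlo
  linarith

/-- **The coned profile is irrotational** (`ω₃ ≡ 0` and the cone force `ω ≡ 0`). -/
theorem curl_eq_zero_of_cone {v : ℝ → EuclideanSpace ℝ (Fin 3) → EuclideanSpace ℝ (Fin 3)} (hv : InDoorClass C v)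
    (hsign : SignE3 v) {K : ℝ}
    (hcone : ∀ s < 0, ∀ x, Real.sqrt ((curl (v s) x 0) ^ 2 + (curl (v s) x 1) ^ 2) ≤ K * curl (v s) x 2)
    (hCK : C * (1 + K) < 1) :
    ∀ s < 0, ∀ y, curl (v s) y = 0 := by
  intro s hs y
  have h2 : curl (v s) y 2 = 0 := by rw [← inner_e3_apply]; exact inner_curl_e3_eq_zero_of_cone hv hsign hcone hCK s hs y
  exact eq_zero_of_cone_of_apply_two_eq_zero _ (hcone s hs y) h2

/-- **LIOUVILLE THEOREM FOR THE CONED TIME-ONLY CLASS below `C(1+K) < 1`: `v ≡ 0`** (one vorticity-free slice kills a Type-I ancient mild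
profile, `…HorizontalVorticityFloor.eq_zero_of_curl_parallel_slice`). -/
theorem eq_zero_of_cone {v : ℝ → EuclideanSpace ℝ (Fin 3) → EuclideanSpace ℝ (Fin 3)} (hv : InDoorClass C v)
    (hsign : SignE3 v) {K : ℝ}
    (hcone : ∀ s < 0, ∀ x, Real.sqrt ((curl (v s) x 0) ^ 2 + (curl (v s) x 1) ^ 2) ≤ K * curl (v s) x 2)
    (hCK : C * (1 + K) < 1) :
    ∀ t < 0, ∀ x, v t x = 0 := by
  obtain ⟨hrate, hcont, hmild, hdiv⟩ := hv
  have hA : IsTypeIAncientMild C v := isTypeIAncientMild_of_class hrate hcont hmild hdiv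
  have hcurl := curl_eq_zero_of_cone ⟨hrate, hcont, hmild, hdiv⟩ hsign hcone hCK
  have he3 : e3 ≠ 0 := by
    intro h
    have h2 := congrArg (fun w : EuclideanSpace ℝ (Fin 3) => w 2) h
    simp [e3] at h2
  exact eq_zero_of_curl_parallel_slice hA (s₀ := -1) (by norm_num) he3 fun y =>
    ⟨0, by rw [hcurl (-1) (by norm_num) y, zero_smul]⟩

/-- **The apex of a coned closed-hemisphere door-class profile with `C(1+K) < 1` is not backward-singular** (the profile vanishes). -/
theorem not_isBackwardSingularPoint_of_cone {v : ℝ → EuclideanSpace ℝ (Fin 3) → EuclideanSpace ℝ (Fin 3)} (hv : InDoorClass C v)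
    (hsign : SignE3 v) {K : ℝ}
    (hcone : ∀ s < 0, ∀ x, Real.sqrt ((curl (v s) x 0) ^ 2 + (curl (v s) x 1) ^ 2) ≤ K * curl (v s) x 2)
    (hCK : C * (1 + K) < 1) :
    ¬ IsBackwardSingularPoint v 0 := by
  intro hsing
  have h0 := eq_zero_of_cone hv hsign hcone hCK
  have hnorm : eLpNorm (uncurry v) ⊤
      (volume.restrict (parabolicCylinder 1 (0 : ℝ × EuclideanSpace ℝ (Fin 3)))) = 0 := by
    rw [eLpNorm_congr_ae (g := 0) ?_, eLpNorm_zero]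
    filter_upwards [ae_restrict_mem (isOpen_parabolicCylinder _ _).measurableSet] with w hw
    have hw0 : w.1 < 0 := by
      rw [mem_parabolicCylinder] at hw
      simpa using hw.1.2
    exact h0 w.1 hw0 w.2
  have htop := hsing 1 one_pos
  rw [hnorm] at htop
  exact ENNReal.zero_ne_top htop

/-- **LRT's spelling of the cone** (arXiv:2501.08976, Remark 1.2: `|ω| ≤ K'·|ω₃|` in high-vorticity regions; here the scale-invariant
single-cone form `‖ω‖ ≤ K'·⟪ω, e₃⟫` with `K' ≥ 0`, which forces the closed-hemisphere sign): in the time-only class with `C(1 + K') < 1`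
such a profile vanishes identically. -/
theorem eq_zero_of_vorticity_cone {v : ℝ → EuclideanSpace ℝ (Fin 3) → EuclideanSpace ℝ (Fin 3)} (hv : InDoorClass C v) {K' : ℝ}
    (hK : 0 ≤ K') (hcone : ∀ s < 0, ∀ x, ‖curl (v s) x‖ ≤ K' * ⟪curl (v s) x, e3⟫) (hCK : C * (1 + K') < 1) :
    ∀ t < 0, ∀ x, v t x = 0 := by
  have h3 : ∀ s x, |curl (v s) x 2| ≤ ‖curl (v s) x‖ := fun s x => by
    rw [← Real.norm_eq_abs]; exact PiLp.norm_apply_le (curl (v s) x) 2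
  have hsign : SignE3 v := fun s hs x => by
    have h := hcone s hs x
    rw [inner_e3_apply] at h ⊢
    by_contra hneg
    push Not at hneg
    have hn : ‖curl (v s) x‖ ≤ 0 := by nlinarith [norm_nonneg (curl (v s) x)]
    have hab := abs_le.1 ((h3 s x).trans hn)
    linarith [hab.1, hab.2]
  refine eq_zero_of_cone hv hsign (K := K') (fun s hs x => ?_) hCK
  have h := hcone s hs x
  rw [inner_e3_apply] at h
  refine le_trans ?_ h
  -- `√(ω₀² + ω₁²) ≤ ‖ω‖`
  have hsq : (curl (v s) x 0) ^ 2 + (curl (v s) x 1) ^ 2 ≤ ‖curl (v s) x‖ ^ 2 :=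
    Literature.Analysis.FluidPDE.Wei2016.sq_add_sq_le_norm_sq _
  exact (Real.sqrt_le_sqrt hsq).trans (Real.sqrt_sq (norm_nonneg _)).le

end Summit.NavierStokesRegularity.NavierStokesRegularity.Theorems.HalfSpaceWindowDoorCirculationCarryingRigidityGaussExtremalCone

end
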